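import Mathlib
import HarnessLib

/-!
# Route `LocalPressureProfileDoor`, crux K2⁺ `MonotonePressureProfileRigidity` (stmt-NavierStokesRegularity-20180),
# line `birth`, stub `stub_smallSliceOfMonotonePressure` — helper 4a: a Dini-type fundamental inequality of calculus

Cell ns-regularity-ideate, seat ns-pressure-K2-p1 (LEAD; helper file, lands `--supports stmt-NavierStokesRegularity-20180`).

The monotonicity of the similarity pressure enters the budget through the diagonal function `D(t) = Φ_t(t)` of the
two-parameter pairing `Φ_τ(t) = ∫ q_τ(t) G(t)` (frozen slice `τ`, kernel time `t`): `τ ↦ Φ_τ(t)` is non-increasing and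
`t ↦ Φ_τ(t)` is differentiable at `t = τ` with derivative `γ(τ)`, so `D(u) − D(t) ≤ Φ_t(u) − Φ_t(t)` for `u > t` and the
UPPER RIGHT DINI DERIVATIVE of `D` is at most `γ`.  `D` itself need not be differentiable.  This file proves the version of
the second fundamental inequality of calculus that needs only that:

* `sub_le_integral_of_rightDini_le` — if `g` is continuous on `[a,b]`, `φ` is integrable on `[a,b]`, `g' ≤ φ` on `[a,b)`, and at
  every `x ∈ [a,b)` and every `y > g'(x)` eventually (as `u ↓ x`) `g(u) − g(x) ≤ (u − x) y`, then `g(b) − g(a) ≤ ∫_a^b φ`.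

It is Mathlib's `intervalIntegral.sub_le_integral_of_hasDeriv_right_of_le_Ico` (whose proof uses the right derivative only
through this one-sided slope bound) with the hypothesis weakened accordingly; the proof is copied from Mathlib with that single
change.

WHAT THIS IS NOT: not a claim about Navier–Stokes; real analysis for the budget of the L stub.
-/

noncomputable section

set_option linter.dupNamespace false -- the summit and its sub-problem share the name (CONVENTIONS §1)

namespace Summit.NavierStokesRegularity.NavierStokesRegularity.Theorems.LocalPressureProfileDoorMonotonePressureProfileRigiditySmallSliceDini

open MeasureTheory Set Filter Topology intervalIntegral

/-- **FTC-2 as an inequality under an upper right Dini bound.**  Let `g : ℝ → ℝ` be continuous on `[a, b]` and suppose that at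
every `x ∈ [a, b)`, for every `y > g'(x)`, eventually as `u ↓ x` one has `g(u) − g(x) ≤ (u − x) y` (the upper right Dini
derivative of `g` at `x` is at most `g'(x)`).  If `φ` is integrable on `[a, b]` and `g' ≤ φ` on `[a, b)`, then
`g(b) − g(a) ≤ ∫_a^b φ`.  (Mathlib's `sub_le_integral_of_hasDeriv_right_of_le_Ico`, proof copied, with the right
derivative replaced by the Dini bound — the only way the derivative is used there.) [folklore] -/
theorem sub_le_integral_of_rightDini_le {g g' φ : ℝ → ℝ} {a b : ℝ} (hab : a ≤ b)
    (hcont : ContinuousOn g (Icc a b))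
    (hdini : ∀ x ∈ Ico a b, ∀ y : ℝ, g' x < y → ∀ᶠ u in 𝓝[>] x, g u - g x ≤ (u - x) * y)
    (φint : IntegrableOn φ (Icc a b)) (hφg : ∀ x ∈ Ico a b, g' x ≤ φ x) :
    g b - g a ≤ ∫ y in a..b, φ y := by
  -- adapted from Mathlib.MeasureTheory.Integral.IntervalIntegral.FundThmCalculus
  refine le_of_forall_pos_le_add fun ε εpos => ?_
  -- Bound from above `g'` by a lower-semicontinuous function `G'`.
  rcases exists_lt_lowerSemicontinuous_integral_lt φ φint εpos with
    ⟨G', f_lt_G', G'cont, G'int, G'lt_top, hG'⟩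
  -- we will show by "induction" that `g t - g a ≤ ∫ u in a..t, G' u` for all `t ∈ [a, b]`.
  set s := {t | g t - g a ≤ ∫ u in a..t, (G' u).toReal} ∩ Icc a b
  -- the set `s` of points where this property holds is closed.
  have s_closed : IsClosed s := by
    have : ContinuousOn (fun t => (g t - g a, ∫ u in a..t, (G' u).toReal)) (Icc a b) := by
      rw [← uIcc_of_le hab] at G'int hcont ⊢
      exact (hcont.sub continuousOn_const).prodMk (continuousOn_primitive_interval G'int)
    simp only [s, inter_comm]
    exact this.preimage_isClosed_of_isClosed isClosed_Icc OrderClosedTopology.isClosed_le'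
  have main : Icc a b ⊆ {t | g t - g a ≤ ∫ u in a..t, (G' u).toReal} := by
    -- to show that the set `s` is all `[a, b]`, it suffices to show that any point `t` in `s`
    -- with `t < b` admits another point in `s` slightly to its right
    -- (this is a sort of real induction).
    refine s_closed.Icc_subset_of_forall_exists_gt
      (by simp only [integral_same, mem_setOf_eq, sub_self, le_rfl]) fun t ht v t_lt_v => ?_
    obtain ⟨y, g'_lt_y', y_lt_G'⟩ : ∃ y : ℝ, (g' t : EReal) < y ∧ (y : EReal) < G' t :=
      EReal.lt_iff_exists_real_btwn.1 ((EReal.coe_le_coe_iff.2 (hφg t ht.2)).trans_lt (f_lt_G' t))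
    -- bound from below the increase of `∫ x in a..u, G' x` on the right of `t`, using the lower
    -- semicontinuity of `G'`.
    have I1 : ∀ᶠ u in 𝓝[>] t, (u - t) * y ≤ ∫ w in t..u, (G' w).toReal := by
      have B : ∀ᶠ u in 𝓝 t, (y : EReal) < G' u := G'cont.lowerSemicontinuousAt _ _ y_lt_G'
      rcases mem_nhds_iff_exists_Ioo_subset.1 B with ⟨m, M, ⟨hm, hM⟩, H⟩
      have : Ioo t (min M b) ∈ 𝓝[>] t := Ioo_mem_nhdsGT (lt_min hM ht.right.right)
      filter_upwards [this] with u hu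
      have I : Icc t u ⊆ Icc a b := Icc_subset_Icc ht.2.1 (hu.2.le.trans (min_le_right _ _))
      calc
        (u - t) * y = ∫ _ in Icc t u, y := by
          simp only [MeasureTheory.integral_const, MeasurableSet.univ, measureReal_restrict_apply,
            univ_inter, hu.left.le, Real.volume_real_Icc_of_le, smul_eq_mul]
        _ ≤ ∫ w in t..u, (G' w).toReal := by
          rw [intervalIntegral.integral_of_le hu.1.le, ← integral_Icc_eq_integral_Ioc]
          apply setIntegral_mono_ae_restrict
          · simp
          · exact IntegrableOn.mono_set G'int I
          · have C1 : ∀ᵐ x : ℝ ∂volume.restrict (Icc t u), G' x < ⊤ :=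
              ae_mono (Measure.restrict_mono I le_rfl) G'lt_top
            have C2 : ∀ᵐ x : ℝ ∂volume.restrict (Icc t u), x ∈ Icc t u :=
              ae_restrict_mem measurableSet_Icc
            filter_upwards [C1, C2] with x G'x hx
            apply EReal.coe_le_coe_iff.1
            have : x ∈ Ioo m M := by
              simp only [hm.trans_le hx.left,
                (hx.right.trans_lt hu.right).trans_le (min_le_left M b), mem_Ioo, and_self_iff]
            refine (H this).out.le.trans_eq ?_
            exact (EReal.coe_toReal G'x.ne (f_lt_G' x).ne_bot).symm
    -- bound from above the increase of `g u - g a` on the right of `t`, using the Dini bound at `t`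
    have I2 : ∀ᶠ u in 𝓝[>] t, g u - g t ≤ (u - t) * y :=
      hdini t ⟨ht.2.1, ht.2.2⟩ y (EReal.coe_lt_coe_iff.1 g'_lt_y')
    -- combine the previous two bounds to show that `g u - g a` increases less quickly than
    -- `∫ x in a..u, G' x`.
    have I3 : ∀ᶠ u in 𝓝[>] t, g u - g t ≤ ∫ w in t..u, (G' w).toReal := by
      filter_upwards [I1, I2] with u hu1 hu2 using hu2.trans hu1
    have I4 : ∀ᶠ u in 𝓝[>] t, u ∈ Ioc t (min v b) := Ioc_mem_nhdsGT <| lt_min t_lt_v ht.2.2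
    -- choose a point `x` slightly to the right of `t` which satisfies the above bound
    rcases (I3.and I4).exists with ⟨x, hx, h'x⟩
    -- we check that it belongs to `s`, essentially by construction
    refine ⟨x, ?_, Ioc_subset_Ioc le_rfl (min_le_left _ _) h'x⟩
    calc
      g x - g a = g t - g a + (g x - g t) := by abel
      _ ≤ (∫ w in a..t, (G' w).toReal) + ∫ w in t..x, (G' w).toReal := add_le_add ht.1 hx
      _ = ∫ w in a..x, (G' w).toReal := by
        apply integral_add_adjacent_intervals
        · rw [intervalIntegrable_iff_integrableOn_Ioc_of_le ht.2.1]
          exact IntegrableOn.mono_set G'int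
            (Ioc_subset_Icc_self.trans (Icc_subset_Icc le_rfl ht.2.2.le))
        · rw [intervalIntegrable_iff_integrableOn_Ioc_of_le h'x.1.le]
          apply IntegrableOn.mono_set G'int
          exact Ioc_subset_Icc_self.trans (Icc_subset_Icc ht.2.1 (h'x.2.trans (min_le_right _ _)))
  -- now that we know that `s` contains `[a, b]`, we get the desired result by applying this to `b`.
  calc
    g b - g a ≤ ∫ y in a..b, (G' y).toReal := main (right_mem_Icc.2 hab)
    _ ≤ (∫ y in a..b, φ y) + ε := by
      convert! hG'.le <;>
        · rw [intervalIntegral.integral_of_le hab]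
          simp only [integral_Icc_eq_integral_Ioc', Real.volume_singleton]

/-- **The Dini bound from a differentiable majorant.**  If `g u − g x ≤ f u − f x` for all `u > x` near `x` and `f` has
derivative `f'` at `x`, then for every `y > f'` eventually (as `u ↓ x`) `g u − g x ≤ (u − x) y` — the hypothesis `hdini` of
`sub_le_integral_of_rightDini_le` with `g' x = f'`. [folklore] -/
theorem rightDini_of_le_of_hasDerivAt {g f : ℝ → ℝ} {f' x : ℝ} (hf : HasDerivAt f f' x)
    (hle : ∀ᶠ u in 𝓝[>] x, g u - g x ≤ f u - f x) {y : ℝ} (hy : f' < y) :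
    ∀ᶠ u in 𝓝[>] x, g u - g x ≤ (u - x) * y := by
  have h1 : ∀ᶠ u in 𝓝[>] x, slope f x u < y :=
    (hf.hasDerivWithinAt (s := Ioi x)).limsup_slope_le' (notMem_Ioi.2 le_rfl) hy
  filter_upwards [hle, h1, self_mem_nhdsWithin] with u hu h'u hxu
  have hxu' : 0 < u - x := sub_pos.2 hxu
  have h2 : f u - f x < (u - x) * y := by
    rw [slope_def_field] at h'u
    rwa [div_lt_iff₀ hxu', mul_comm] at h'u
  exact hu.trans h2.le

end Summit.NavierStokesRegularity.NavierStokesRegularity.Theorems.LocalPressureProfileDoorMonotonePressureProfileRigiditySmallSliceDini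

end
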